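import Summits.AnomalousDissipation.AnomalousDissipation.Theses.TameRoughRigidity
import Summits.AnomalousDissipation.AnomalousDissipation.Theorems.GPStatisticalRigidity.Negative.LoadBearing
import Summits.AnomalousDissipation.AnomalousDissipation.Theorems.EnsembleRigidityGPStatisticalRigidityDesaturation
import Summits.AnomalousDissipation.AnomalousDissipation.Theorems.EnsembleRigidityResidualTransferSSSTestEnstrophyTame
import Literature.Analysis.FluidPDE.CylindricalGenerator
import Literature.Analysis.FluidPDE.StatisticalSolutionProofs
import HarnessLib

/-!
# Tools stub `stub_witnessParityTools` of line `Sketch` (crux stmt-AnomalousDissipation-18401,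
  `TameRoughRigidity.TameToRough`)

Parity tools for the witness form of the co-signed floor of the line (the lead's
`WitnessForm`): seven elementary facts, packaged as the registered conjunction
`stub_witnessParityTools`.

1. On an EVEN measure `μ` on the energy space `H` (`T_* μ = μ`, `T v = −v`) one has
   `∫ h(−v) dμ = ∫ h dμ` for EVERY `h : H → ℝ` (change of variables through the measurable
   involution `MeasurableEquiv.neg H`; no measurability of `h` is needed).
2. On an even measure, integrability transfers through `v ↦ −v`.
3. The coordinates of a cylindrical test functional are odd, `coords(−v) = −coords v` (the
   pairing `(v, g)` is linear in `v`; the `hc` step of `desaturation_exists_reflect`).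
4. The parallelogram law `‖∇∑(aᵢ+bᵢ)gᵢ‖² + ‖∇∑(−aᵢ+bᵢ)gᵢ‖² = 2‖∇∑aᵢgᵢ‖² + 2‖∇∑bᵢgᵢ‖²`,
5. the homogeneity `‖∇∑(t aᵢ)gᵢ‖² = t² ‖∇∑aᵢgᵢ‖²`, and
6. the crude bound `‖∇∑aᵢgᵢ‖² ≤ m M² ∑ᵢ ‖∇gᵢ‖²` (`|aᵢ| ≤ M`) for test enstrophies of finite
   combinations of `m` smooth fields on `T³` — all three through the Gram expansion
   `‖∇∑cᵢgᵢ‖² = ∑ᵢᵢ' cᵢcᵢ' Aᵢᵢ'` (`ResidualTransferSSS.gradNormSq_sum_smul_eq_gram`) and, for (6),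
   the bound `|Aᵢᵢ'| ≤ ½(‖∇gᵢ‖² + ‖∇gᵢ'‖²)` on the Gram entries (Cauchy–Schwarz and AM–GM
   pointwise, integrated over the compact torus).
7. The odd part `θₒ(c) = ½(θ(c) − θ(−c))` of a `C¹` compactly supported profile `θ : ℝᵐ → ℝ` is
   `C¹` and compactly supported; `Dθ = Dθₑ + Dθₒ` with the even part `θₑ(c) = ½(θ(c) + θ(−c))`;
   `Dθₑ` is odd and `Dθₒ` is even (chain rule through `c ↦ −c`,
   `desaturation_fderiv_comp_neg`); `θₒ` is bounded; and `θₒ`, `Dθₒ` vanish outside a ball (the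
   topological support of `θₒ` is compact, hence inside a ball, and `Dθₒ = 0` off `tsupport θₒ`).

## References

* C. Foias, O. Manley, R. Rosa, R. Temam, *Navier–Stokes Equations and Turbulence* (CUP 2001),
  Ch. IV §1.2 Def. 1.2–1.3 (cylindrical test functionals on `H`). [FoiasManleyRosaTemam2001]
-/

set_option linter.dupNamespace false

noncomputable section

namespace Summit.AnomalousDissipation.AnomalousDissipation.Theorems.TameRoughRigidity.TameToRough

open MeasureTheory Filter Topology UnitAddTorus
open scoped InnerProductSpace RealInnerProductSpace ENNReal NNReal
open Literature.Analysis.FunctionSpaces Literature.Analysis.FluidPDE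
open Summit.AnomalousDissipation.AnomalousDissipation.Theses.TameRoughRigidity
open Summit.AnomalousDissipation.AnomalousDissipation.Theorems.GPStatisticalRigidity.Negative
open Summit.AnomalousDissipation.AnomalousDissipation.Theorems.EnsembleRigidity.GPStatisticalRigidity

/-- Local notation: real vector fields on `T³`. -/
local notation "Vec3" => (UnitAddTorus (Fin 3)) → (EuclideanSpace ℝ (Fin 3))
/-- Local notation: `L²(T³; ℝ³)`. -/
local notation "L2" => (Lp (EuclideanSpace ℝ (Fin 3)) 2 (volume : Measure (UnitAddTorus (Fin 3))))
/-- Local notation: the energy space `H`. -/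
local notation "H3" => (Torus.energySpace (Fin 3))

/-! ### (1), (2): even measures on `H` -/

/-- On an even measure (`T_* μ = μ`, `T v = −v`) one has `∫ h(−v) dμ = ∫ h dμ` for every
`h : H → ℝ` (change of variables through the measurable involution `T`). [folklore] -/
theorem witnessParity_integral_neg (μ : Measure H3) (heven : μ.map (fun v : H3 => -v) = μ)
    (h : H3 → ℝ) : ∫ v, h (-v) ∂μ = ∫ v, h v ∂μ := by
  have hTa : ∀ v : H3, MeasurableEquiv.neg H3 v = -v := fun v => by simp
  have hfun : (fun v : H3 => -v) = ⇑(MeasurableEquiv.neg H3) := funext fun v => (hTa v).symm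
  rw [hfun] at heven
  calc ∫ v, h (-v) ∂μ = ∫ v, h v ∂(μ.map (MeasurableEquiv.neg H3)) := by
        rw [integral_map_equiv]
        simp only [hTa]
    _ = ∫ v, h v ∂μ := by rw [heven]

/-- On an even measure, integrability transfers through `v ↦ −v`. [folklore] -/
theorem witnessParity_integrable_neg (μ : Measure H3) (heven : μ.map (fun v : H3 => -v) = μ)
    (h : H3 → ℝ) (hh : Integrable h μ) : Integrable (fun v : H3 => h (-v)) μ := by
  have hTa : ∀ v : H3, MeasurableEquiv.neg H3 v = -v := fun v => by simp
  have hfun : (fun v : H3 => -v) = ⇑(MeasurableEquiv.neg H3) := funext fun v => (hTa v).symm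
  rw [hfun] at heven
  have h1 : Integrable h (μ.map (MeasurableEquiv.neg H3)) := by
    rw [heven]
    exact hh
  simpa only [Function.comp_def, hTa] using (integrable_map_equiv (MeasurableEquiv.neg H3) h).1 h1

/-! ### (3): the coordinates of a cylindrical test functional are odd -/

/-- The work functional is odd: `(−v, g) = −(v, g)` for `g ∈ L²` (the copies in the pattern files
`EnsembleRigidityGPStatisticalRigidityDesaturation`, `TameRoughRigidityTameToRoughEvenSymmetrise`
are private). [folklore] -/
private theorem witnessParity_pairing_neg {g : Vec3} (hg : MemLp g 2 volume) (v : H3) :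
    Torus.pairing (((-v : H3) : L2)) g = -Torus.pairing ((v : H3) : L2) g := by
  -- adapted from `GPStatisticalRigidity.desaturation_pairing_neg`
  rw [Submodule.coe_neg, Torus.pairing_eq_inner hg, Torus.pairing_eq_inner hg, inner_neg_left]

/-- The coordinates `((v,g₁),…,(v,gₘ))` of a cylindrical test functional are odd in `v`:
`coords(−v) = −coords v`. [folklore] -/
theorem witnessParity_coords_neg (Θ : Torus.CylindricalTest (Fin 3)) (v : H3) :
    Θ.coords (-v) = -Θ.coords v := by
  -- adapted from the `hc` step of `GPStatisticalRigidity.desaturation_exists_reflect`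
  unfold Torus.CylindricalTest.coords
  rw [← WithLp.toLp_neg]
  congr 1
  funext i
  rw [Pi.neg_apply]
  exact witnessParity_pairing_neg ((Θ.g_smooth i).memLp 2) v

/-! ### (4), (5), (6): test enstrophies of finite combinations of smooth fields -/

/-- **Parallelogram law** for test enstrophies:
`‖∇∑(aᵢ+bᵢ)gᵢ‖² + ‖∇∑(−aᵢ+bᵢ)gᵢ‖² = 2‖∇∑aᵢgᵢ‖² + 2‖∇∑bᵢgᵢ‖²` (Gram expansion). [folklore] -/
theorem witnessParity_parallelogram (m : ℕ) (g : Fin m → Vec3) (hg : ∀ i, Torus.IsSmooth (g i))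
    (a b : Fin m → ℝ) :
    Torus.gradNormSq (fun x => ∑ i, (a i + b i) • g i x) +
        Torus.gradNormSq (fun x => ∑ i, (-a i + b i) • g i x) =
      2 * Torus.gradNormSq (fun x => ∑ i, a i • g i x) +
        2 * Torus.gradNormSq (fun x => ∑ i, b i • g i x) := by
  rw [ResidualTransferSSS.gradNormSq_sum_smul_eq_gram hg (fun i => a i + b i),
    ResidualTransferSSS.gradNormSq_sum_smul_eq_gram hg (fun i => -a i + b i),
    ResidualTransferSSS.gradNormSq_sum_smul_eq_gram hg a,
    ResidualTransferSSS.gradNormSq_sum_smul_eq_gram hg b]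
  simp only [Finset.mul_sum, ← Finset.sum_add_distrib]
  refine Finset.sum_congr rfl fun i _ => Finset.sum_congr rfl fun i' _ => ?_
  ring

/-- **Homogeneity** of test enstrophies: `‖∇∑(t aᵢ)gᵢ‖² = t² ‖∇∑aᵢgᵢ‖²` (Gram expansion).
[folklore] -/
theorem witnessParity_homog (m : ℕ) (g : Fin m → Vec3) (hg : ∀ i, Torus.IsSmooth (g i))
    (t : ℝ) (a : Fin m → ℝ) :
    Torus.gradNormSq (fun x => ∑ i, (t * a i) • g i x) =
      t ^ 2 * Torus.gradNormSq (fun x => ∑ i, a i • g i x) := by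
  rw [ResidualTransferSSS.gradNormSq_sum_smul_eq_gram hg (fun i => t * a i),
    ResidualTransferSSS.gradNormSq_sum_smul_eq_gram hg a]
  simp only [Finset.mul_sum]
  refine Finset.sum_congr rfl fun i _ => Finset.sum_congr rfl fun i' _ => ?_
  ring

/-- The Gram entries are bounded by the enstrophies:
`|∫ ∑ⱼ ⟪∂ⱼg, ∂ⱼg'⟫| ≤ ½(‖∇g‖² + ‖∇g'‖²)` (Cauchy–Schwarz and AM–GM pointwise, integrated over
the compact torus where the continuous integrands are integrable). [folklore] -/
theorem witnessParity_gram_le {g g' : Vec3} (hg : Torus.IsSmooth g) (hg' : Torus.IsSmooth g') :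
    |∫ y, ∑ j, ⟪Torus.partialDeriv j g y, Torus.partialDeriv j g' y⟫_ℝ| ≤
      2⁻¹ * (Torus.gradNormSq g + Torus.gradNormSq g') := by
  have hint : ∀ {w : Vec3}, Torus.IsSmooth w →
      Integrable (fun y => ∑ j, ‖Torus.partialDeriv j w y‖ ^ 2) volume := fun hw =>
    (continuous_finsetSum _ fun j _ =>
      ((hw.partialDeriv j).continuous.norm.pow 2)).integrable_unitAddTorus
  have hpt : ∀ y, |∑ j, ⟪Torus.partialDeriv j g y, Torus.partialDeriv j g' y⟫_ℝ| ≤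
      2⁻¹ * (∑ j, ‖Torus.partialDeriv j g y‖ ^ 2 + ∑ j, ‖Torus.partialDeriv j g' y‖ ^ 2) := by
    intro y
    rw [← Finset.sum_add_distrib, Finset.mul_sum]
    refine (Finset.abs_sum_le_sum_abs _ _).trans (Finset.sum_le_sum fun j _ => ?_)
    have h1 := abs_real_inner_le_norm (Torus.partialDeriv j g y) (Torus.partialDeriv j g' y)
    have h2 := two_mul_le_add_sq ‖Torus.partialDeriv j g y‖ ‖Torus.partialDeriv j g' y‖
    linarith
  have hI : Integrable (fun y => 2⁻¹ * (∑ j, ‖Torus.partialDeriv j g y‖ ^ 2 +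
      ∑ j, ‖Torus.partialDeriv j g' y‖ ^ 2)) volume := ((hint hg).add (hint hg')).const_mul 2⁻¹
  calc |∫ y, ∑ j, ⟪Torus.partialDeriv j g y, Torus.partialDeriv j g' y⟫_ℝ|
      ≤ ∫ y, |∑ j, ⟪Torus.partialDeriv j g y, Torus.partialDeriv j g' y⟫_ℝ| :=
        abs_integral_le_integral_abs
    _ ≤ ∫ y, 2⁻¹ * (∑ j, ‖Torus.partialDeriv j g y‖ ^ 2 + ∑ j, ‖Torus.partialDeriv j g' y‖ ^ 2) :=
        integral_mono_of_nonneg (ae_of_all _ fun y => abs_nonneg _) hI (ae_of_all _ hpt)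
    _ = 2⁻¹ * (Torus.gradNormSq g + Torus.gradNormSq g') := by
        rw [integral_const_mul, integral_add (hint hg) (hint hg')]
        rfl

/-- **Crude bound** `‖∇∑aᵢgᵢ‖² ≤ m M² ∑ᵢ ‖∇gᵢ‖²` for coefficients `|aᵢ| ≤ M` (Gram expansion and
`|aᵢaᵢ'Aᵢᵢ'| ≤ M² · ½(‖∇gᵢ‖² + ‖∇gᵢ'‖²)`; the case `m = 0` reads `0 ≤ 0`). [folklore] -/
theorem witnessParity_crude (m : ℕ) (g : Fin m → Vec3) (hg : ∀ i, Torus.IsSmooth (g i)) (M : ℝ)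
    (a : Fin m → ℝ) (ha : ∀ i, |a i| ≤ M) :
    Torus.gradNormSq (fun x => ∑ i, a i • g i x) ≤ m * M ^ 2 * ∑ i, Torus.gradNormSq (g i) := by
  rw [ResidualTransferSSS.gradNormSq_sum_smul_eq_gram hg a]
  calc ∑ i, ∑ i', a i * a i' *
          ∫ y, ∑ j, ⟪Torus.partialDeriv j (g i) y, Torus.partialDeriv j (g i') y⟫_ℝ
      ≤ ∑ i, ∑ i', M ^ 2 * 2⁻¹ * (Torus.gradNormSq (g i) + Torus.gradNormSq (g i')) := by
        refine Finset.sum_le_sum fun i _ => Finset.sum_le_sum fun i' _ => ?_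
        have hM0 : 0 ≤ M := (abs_nonneg _).trans (ha i)
        refine (le_abs_self _).trans ?_
        rw [abs_mul, abs_mul, mul_assoc (M ^ 2)]
        refine mul_le_mul ?_ (witnessParity_gram_le (hg i) (hg i')) (abs_nonneg _) (sq_nonneg M)
        rw [sq]
        exact mul_le_mul (ha i) (ha i') (abs_nonneg _) hM0
    _ = m * M ^ 2 * ∑ i, Torus.gradNormSq (g i) := by
        simp only [mul_add, Finset.sum_add_distrib, Finset.sum_const, Finset.card_univ,
          Fintype.card_fin, nsmul_eq_mul, ← Finset.mul_sum]
        ring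

/-! ### (7): odd and even parts of a `C¹_c` profile -/

/-- **Odd/even parts of a `C¹_c` profile `θ : ℝᵐ → ℝ`.** The odd part
`θₒ(c) = ½(θ(c) − θ(−c))` is `C¹` and compactly supported; `Dθ = Dθₑ + Dθₒ` with
`θₑ(c) = ½(θ(c) + θ(−c))`; `Dθₑ(−c) = −Dθₑ(c)` and `Dθₒ(−c) = Dθₒ(c)`; `θₒ` is bounded; and
`θₒ`, `Dθₒ` vanish outside a ball. [folklore] -/
theorem witnessParity_oddPart (m : ℕ) (θ : EuclideanSpace ℝ (Fin m) → ℝ) (hθ : ContDiff ℝ 1 θ)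
    (hθc : HasCompactSupport θ) :
    ContDiff ℝ 1 (fun c => 2⁻¹ * (θ c - θ (-c))) ∧
      HasCompactSupport (fun c => 2⁻¹ * (θ c - θ (-c))) ∧
      (∀ c e, fderiv ℝ θ c e =
        fderiv ℝ (fun c => 2⁻¹ * (θ c + θ (-c))) c e +
          fderiv ℝ (fun c => 2⁻¹ * (θ c - θ (-c))) c e) ∧
      (∀ c e, fderiv ℝ (fun c => 2⁻¹ * (θ c + θ (-c))) (-c) e =
        -fderiv ℝ (fun c => 2⁻¹ * (θ c + θ (-c))) c e) ∧
      (∀ c e, fderiv ℝ (fun c => 2⁻¹ * (θ c - θ (-c))) (-c) e =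
        fderiv ℝ (fun c => 2⁻¹ * (θ c - θ (-c))) c e) ∧
      (∃ M : ℝ, 0 ≤ M ∧ ∀ c, |2⁻¹ * (θ c - θ (-c))| ≤ M) ∧
      (∃ ρ : ℝ, 0 < ρ ∧ ∀ c, ρ ≤ ‖c‖ →
        2⁻¹ * (θ c - θ (-c)) = 0 ∧ fderiv ℝ (fun c => 2⁻¹ * (θ c - θ (-c))) c = 0) := by
  -- `θ` and `θ ∘ neg`: differentiability and support
  have hθn : ContDiff ℝ 1 (fun c => θ (-c)) := hθ.comp contDiff_neg
  have hdθ : Differentiable ℝ θ := hθ.differentiable one_ne_zero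
  have hdθn : Differentiable ℝ (fun c => θ (-c)) := hθn.differentiable one_ne_zero
  have hθnc : HasCompactSupport (fun c => θ (-c)) := hθc.comp_homeomorph (Homeomorph.neg _)
  -- the odd part: smoothness and support
  have ho1 : ContDiff ℝ 1 (fun c => 2⁻¹ * (θ c - θ (-c))) := contDiff_const.mul (hθ.sub hθn)
  have hoc : HasCompactSupport (fun c => 2⁻¹ * (θ c - θ (-c))) := (hθc.sub hθnc).mul_left
  -- derivatives of `θ ∘ neg`, `θₑ`, `θₒ`
  have hN : ∀ y e, fderiv ℝ (fun c => θ (-c)) y e = -fderiv ℝ θ (-y) e :=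
    fun y e => desaturation_fderiv_comp_neg hθ y e
  have hE : ∀ c, fderiv ℝ (fun c => 2⁻¹ * (θ c + θ (-c))) c =
      (2⁻¹ : ℝ) • (fderiv ℝ θ c + fderiv ℝ (fun c => θ (-c)) c) := fun c =>
    (((hdθ c).hasFDerivAt.add (hdθn c).hasFDerivAt).const_mul 2⁻¹).fderiv
  have hO : ∀ c, fderiv ℝ (fun c => 2⁻¹ * (θ c - θ (-c))) c =
      (2⁻¹ : ℝ) • (fderiv ℝ θ c - fderiv ℝ (fun c => θ (-c)) c) := fun c =>
    (((hdθ c).hasFDerivAt.sub (hdθn c).hasFDerivAt).const_mul 2⁻¹).fderiv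
  refine ⟨ho1, hoc, fun c e => ?_, fun c e => ?_, fun c e => ?_, ?_, ?_⟩
  · -- `Dθ = Dθₑ + Dθₒ`
    rw [hE, hO]
    simp only [_root_.smul_apply, _root_.add_apply, _root_.sub_apply, smul_eq_mul]
    ring
  · -- `Dθₑ` is odd
    rw [hE, hE]
    simp only [_root_.smul_apply, _root_.add_apply, smul_eq_mul, hN, neg_neg]
    ring
  · -- `Dθₒ` is even
    rw [hO, hO]
    simp only [_root_.smul_apply, _root_.sub_apply, smul_eq_mul, hN, neg_neg]
    ring
  · -- `θₒ` is bounded (continuous with compact support)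
    obtain ⟨C, hC⟩ := ho1.continuous.bounded_above_of_compact_support hoc
    refine ⟨C, (norm_nonneg _).trans (hC 0), fun c => ?_⟩
    rw [← Real.norm_eq_abs]
    exact hC c
  · -- `θₒ` and `Dθₒ` vanish outside a ball containing `tsupport θₒ`
    obtain ⟨r, hr⟩ := hoc.isCompact.isBounded.subset_closedBall 0
    refine ⟨max r 0 + 1, by positivity, fun c hc => ?_⟩
    have hc' : c ∉ tsupport (fun c => 2⁻¹ * (θ c - θ (-c))) := fun h => by
      have h' := hr h
      rw [Metric.mem_closedBall, dist_zero_right] at h'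
      linarith [le_max_left r 0]
    exact ⟨image_eq_zero_of_notMem_tsupport (f := fun c => 2⁻¹ * (θ c - θ (-c))) hc',
      fderiv_of_notMem_tsupport ℝ hc'⟩

/-! ### The registered Tools stub -/

/-- **Tools A `stub_witnessParityTools`.** (1) on an even measure `∫ h(−v) dμ = ∫ h dμ` and (2) integrability
transfers through `v ↦ −v`; (3) `coords(−v) = −coords v`; (4) parallelogram law, (5) homogeneity and (6) the crude
bound `‖∇∑ aᵢgᵢ‖² ≤ m M² ∑ ‖∇gᵢ‖²` for test enstrophies of finite combinations of smooth fields; (7) the odd part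
`θₒ(c) = ½(θ(c) − θ(−c))` of a `C¹_c` profile: `C¹`, compactly supported, the splitting `Dθ = Dθₑ + Dθₒ`, parities of
`Dθₑ`, `Dθₒ`, a uniform bound, and a radius beyond which `θₒ` and `Dθₒ` vanish. [folklore] -/
theorem stub_witnessParityTools :
    (∀ μ : Measure H3, μ.map (fun v : H3 => -v) = μ → ∀ h : H3 → ℝ, ∫ v, h (-v) ∂μ = ∫ v, h v ∂μ) ∧
    (∀ μ : Measure H3, μ.map (fun v : H3 => -v) = μ → ∀ h : H3 → ℝ, Integrable h μ →
      Integrable (fun v : H3 => h (-v)) μ) ∧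
    (∀ (Θ : Torus.CylindricalTest (Fin 3)) (v : H3), Θ.coords (-v) = -Θ.coords v) ∧
    (∀ (m : ℕ) (g : Fin m → Vec3), (∀ i, Torus.IsSmooth (g i)) → ∀ a b : Fin m → ℝ,
      Torus.gradNormSq (fun x => ∑ i, (a i + b i) • g i x) +
          Torus.gradNormSq (fun x => ∑ i, (-a i + b i) • g i x) =
        2 * Torus.gradNormSq (fun x => ∑ i, a i • g i x) +
          2 * Torus.gradNormSq (fun x => ∑ i, b i • g i x)) ∧
    (∀ (m : ℕ) (g : Fin m → Vec3), (∀ i, Torus.IsSmooth (g i)) → ∀ (t : ℝ) (a : Fin m → ℝ),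
      Torus.gradNormSq (fun x => ∑ i, (t * a i) • g i x) =
        t ^ 2 * Torus.gradNormSq (fun x => ∑ i, a i • g i x)) ∧
    (∀ (m : ℕ) (g : Fin m → Vec3), (∀ i, Torus.IsSmooth (g i)) → ∀ (M : ℝ) (a : Fin m → ℝ),
      (∀ i, |a i| ≤ M) →
      Torus.gradNormSq (fun x => ∑ i, a i • g i x) ≤ m * M ^ 2 * ∑ i, Torus.gradNormSq (g i)) ∧
    (∀ (m : ℕ) (θ : EuclideanSpace ℝ (Fin m) → ℝ), ContDiff ℝ 1 θ → HasCompactSupport θ →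
      ContDiff ℝ 1 (fun c => 2⁻¹ * (θ c - θ (-c))) ∧
      HasCompactSupport (fun c => 2⁻¹ * (θ c - θ (-c))) ∧
      (∀ c e, fderiv ℝ θ c e =
        fderiv ℝ (fun c => 2⁻¹ * (θ c + θ (-c))) c e + fderiv ℝ (fun c => 2⁻¹ * (θ c - θ (-c))) c e) ∧
      (∀ c e, fderiv ℝ (fun c => 2⁻¹ * (θ c + θ (-c))) (-c) e =
        -fderiv ℝ (fun c => 2⁻¹ * (θ c + θ (-c))) c e) ∧
      (∀ c e, fderiv ℝ (fun c => 2⁻¹ * (θ c - θ (-c))) (-c) e =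
        fderiv ℝ (fun c => 2⁻¹ * (θ c - θ (-c))) c e) ∧
      (∃ M : ℝ, 0 ≤ M ∧ ∀ c, |2⁻¹ * (θ c - θ (-c))| ≤ M) ∧
      (∃ ρ : ℝ, 0 < ρ ∧ ∀ c, ρ ≤ ‖c‖ →
        2⁻¹ * (θ c - θ (-c)) = 0 ∧ fderiv ℝ (fun c => 2⁻¹ * (θ c - θ (-c))) c = 0)) :=
  ⟨witnessParity_integral_neg, witnessParity_integrable_neg, witnessParity_coords_neg,
    witnessParity_parallelogram, witnessParity_homog, witnessParity_crude, witnessParity_oddPart⟩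

end Summit.AnomalousDissipation.AnomalousDissipation.Theorems.TameRoughRigidity.TameToRough

end
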